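import Literature.Geometry.GaugeTheory.SpincStructureTraceHessian
import Literature.Geometry.GaugeTheory.SelfDualCurvaturePerturbation
import Literature.Geometry.GaugeTheory.SpincConnectionCurvature
import HarnessLib

/-!
# `|∇_A ψ|²` is a smooth global function

Topic `Literature/Geometry/GaugeTheory`; the regularity input for the `L²` bound on `∇_Aψ` of
Taubes 1994, Lemma 3 (and Morgan 1996, §5.2): for a unitary connection `A` on `det P̃` and a smooth
spinor field `ψ`, the pointwise square norm of the `Spin^c` covariant derivative read in a chart,
`|∇_Aψ|²_i(x) = Σ_k |∇̃_{e^{(i)}_k} ψ_i|²(x)` (`gradNormSqChart`), is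

* **independent of the chart** on overlaps (`gradNormSqChart_eq_of_mem_overlap`): `∇̃ψ_i = G_ij ∇̃ψ_j`
  with `G_ij` unitary (`mulVec_covDeriv_eq`), and the trace of the real bilinear form
  `Re⟨∇̃_vψ, ∇̃_wψ⟩` over an orthonormal frame is frame-independent;
* **smooth** on the chart (`contMDiffAt_gradNormSqChart`: `∇̃_{e_k}ψ_i = dψ_i(e_k) + a_i(e_k)ψ_i` with
  `A_i`, the Levi-Civita forms and the frames smooth);

hence `x ↦ |∇_Aψ|²(x)` read in the chart chosen at each point is smooth on `X`
(`contMDiff_gradNormSqChart_indexAt`).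

PROVED, 0 named facts.

## References

* J. W. Morgan, *The Seiberg–Witten Equations and Applications to the Topology of Smooth
  Four-Manifolds* (1996), §3.2 (3.2), §5.2. [MorganSWBook1996]
* C. H. Taubes, *The Seiberg–Witten invariants and symplectic forms*, Math. Res. Lett. 1 (1994)
  809–822, §2 Lemma 3. [Taubes1994]
-/

noncomputable section

open scoped Manifold ContDiff Topology Bundle ComplexConjugate Matrix
open Set Function Filter Bundle Complex
open Literature.Geometry.Lorentzian (PseudoRiemannianMetric)
open Literature.Topology.FourManifolds (SmoothOrientation)

namespace Literature.Geometry.GaugeTheory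

variable {X : Type*} [TopologicalSpace X] [ChartedSpace (EuclideanSpace ℝ (Fin 4)) X] [IsManifold (𝓡 4) ∞ X]

/-- **The derivative of a smooth complex function along a smooth field is smooth** (`y ↦ df_y(W_y)`;
Mathlib's `ContMDiffAt.mfderiv_const` and `ContMDiffAt.clm_apply_of_inCoordinates`, as in the real case
`contMDiffAt_mvfderiv_apply_of_le`). [folklore] -/
theorem contMDiffAt_complexDeriv_apply {f : X → ℂ} {W : Π y : X, TangentSpace (𝓡 4) y} {x : X}
    (hf : ContMDiffAt (𝓡 4) 𝓘(ℝ, ℂ) ∞ f x)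
    (hW : ContMDiffAt (𝓡 4) ((𝓡 4).prod 𝓘(ℝ, EuclideanSpace ℝ (Fin 4))) ∞
      (fun y : X ↦ TotalSpace.mk' (EuclideanSpace ℝ (Fin 4)) (E := (TangentSpace (𝓡 4) : X → Type _)) y (W y)) x) :
    ContMDiffAt (𝓡 4) 𝓘(ℝ, ℂ) ∞ (fun y ↦ complexDeriv f y (W y)) x := by
  have hf' : ContMDiffAt (𝓡 4) 𝓘(ℝ, ℂ) (∞ + 1) f x := by simpa using hf
  have h1 : ContMDiffAt (𝓡 4) 𝓘(ℝ, EuclideanSpace ℝ (Fin 4) →L[ℝ] ℂ) ∞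
      (inTangentCoordinates (𝓡 4) 𝓘(ℝ, ℂ) id f (mfderiv (𝓡 4) 𝓘(ℝ, ℂ) f) x) x :=
    hf'.mfderiv_const (m := ∞) le_rfl
  have h2 : ContMDiffAt (𝓡 4) (𝓘(ℝ, ℂ).prod 𝓘(ℝ, ℂ)) ∞ (fun y ↦ (mfderiv (𝓡 4) 𝓘(ℝ, ℂ) f y (W y) :
      TotalSpace ℂ (TangentSpace 𝓘(ℝ, ℂ) : ℂ → Type _))) x :=
    ContMDiffAt.clm_apply_of_inCoordinates (b₁ := id) (b₂ := f) h1 hW (hf.of_le le_rfl)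
  exact ((contMDiff_snd_tangentBundle_modelSpace ℂ 𝓘(ℝ, ℂ) (n := ∞)).contMDiffAt).comp x h2

omit [IsManifold (𝓡 4) ∞ X] in
/-- Products of smooth complex functions on the manifold are smooth (complex multiplication is a smooth
real-bilinear map). [folklore] -/
theorem ContMDiffAt.mul_complex {f f' : X → ℂ} {x : X} (hf : ContMDiffAt (𝓡 4) 𝓘(ℝ, ℂ) ∞ f x)
    (hf' : ContMDiffAt (𝓡 4) 𝓘(ℝ, ℂ) ∞ f' x) : ContMDiffAt (𝓡 4) 𝓘(ℝ, ℂ) ∞ (fun y ↦ f y * f' y) x :=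
  (contDiff_mul (𝕜 := ℝ) (𝔸 := ℂ)).comp_contMDiffAt (hf.prodMk_space hf')

namespace SpincStructure

variable {g : PseudoRiemannianMetric (𝓡 4) ∞ (EuclideanSpace ℝ (Fin 4)) (TangentSpace (𝓡 4) : X → Type _)}
  {o : SmoothOrientation (𝓡 4) X} {ι : Type*} (𝔰 : SpincStructure g o ι) [g.HasLeviCivita]

/-- **`|∇_Aψ|²` read in the chart `i`**: `Σ_k |∇̃_{e^{(i)}_k} ψ_i|²(x)`. [cite: MorganSWBook1996, §5.2] -/
def gradNormSqChart (A : 𝔰.detLineBundle.Connection) (ψ : SpinorField 𝔰) (i : ι) (x : X) : ℝ :=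
  ∑ k, spinorHermNormSq (covDeriv A ψ i x (𝔰.frame i k x))

/-- `|∇_Aψ|²_i ≥ 0`. [folklore] -/
theorem gradNormSqChart_nonneg (A : 𝔰.detLineBundle.Connection) (ψ : SpinorField 𝔰) (i : ι) (x : X) :
    0 ≤ 𝔰.gradNormSqChart A ψ i x :=
  Finset.sum_nonneg fun _ _ ↦ spinorHermNormSq_nonneg _

/-! ### Chart independence -/

/-- **`|∇̃_v ψ_j| = |∇̃_v ψ_i|` on `U_i ∩ U_j`** (`∇̃ψ_i = G_ij ∇̃ψ_j`, `G_ij` unitary). [cite: MorganSWBook1996, §3.2 (3.2)] -/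
theorem spinorHermNormSq_covDeriv_eq_of_mem_overlap (A : 𝔰.detLineBundle.Connection) {ψ : SpinorField 𝔰}
    (hψ : ψ.IsSmooth) (i j : ι) {x : X} (hx : x ∈ 𝔰.baseSet i ∩ 𝔰.baseSet j) (v : TangentSpace (𝓡 4) x) :
    spinorHermNormSq (covDeriv A ψ j x v) = spinorHermNormSq (covDeriv A ψ i x v) := by
  rw [← 𝔰.mulVec_covDeriv_eq A hψ i j hx v,
    spinorHermNormSq_mulVec_of_conjTranspose_mul_self (𝔰.conjTranspose_transition_mul_self i j hx.1 hx.2)]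

/-- **The real bilinear form `(v, w) ↦ Re⟨∇̃_v ψ_i, ∇̃_w ψ_i⟩`** on `T_x X` (`∇̃_v` is real-linear in `v`).
[cite: MorganSWBook1996, §3.2 (3.2)] -/
def covDerivBilin (A : 𝔰.detLineBundle.Connection) (ψ : SpinorField 𝔰) (i : ι) (x : X) :
    LinearMap.BilinForm ℝ (TangentSpace (𝓡 4) x) :=
  LinearMap.mk₂ ℝ (fun v w ↦ (star (covDeriv A ψ i x v) ⬝ᵥ covDeriv A ψ i x w).re)
    (fun v₁ v₂ w ↦ by
      simp only [𝔰.covDeriv_add_vec, star_add, add_dotProduct, Complex.add_re])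
    (fun c v w ↦ by
      simp only [𝔰.covDeriv_smul_vec, star_smul, Complex.star_def, Complex.conj_ofReal, smul_dotProduct, smul_eq_mul,
        Complex.re_ofReal_mul])
    (fun v w₁ w₂ ↦ by
      simp only [𝔰.covDeriv_add_vec, dotProduct_add, Complex.add_re])
    (fun c v w ↦ by
      simp only [𝔰.covDeriv_smul_vec, dotProduct_smul, smul_eq_mul, Complex.re_ofReal_mul])

/-- On the diagonal the bilinear form is `|∇̃_v ψ_i|²`. [folklore] -/
theorem covDerivBilin_apply_self (A : 𝔰.detLineBundle.Connection) (ψ : SpinorField 𝔰) (i : ι) (x : X)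
    (v : TangentSpace (𝓡 4) x) :
    𝔰.covDerivBilin A ψ i x v v = spinorHermNormSq (covDeriv A ψ i x v) := by
  simp [covDerivBilin, star_dotProduct_self_eq_spinorHermNormSq]

/-- **`|∇_Aψ|²` is chart-independent**: on `U_i ∩ U_j`, `Σ_k |∇̃_{e^{(j)}_k}ψ_j|² = Σ_k |∇̃_{e^{(i)}_k}ψ_i|²`.
[cite: MorganSWBook1996, §3.2, §5.2] -/
theorem gradNormSqChart_eq_of_mem_overlap (A : 𝔰.detLineBundle.Connection) {ψ : SpinorField 𝔰} (hψ : ψ.IsSmooth)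
    (i j : ι) {x : X} (hx : x ∈ 𝔰.baseSet i ∩ 𝔰.baseSet j) :
    𝔰.gradNormSqChart A ψ j x = 𝔰.gradNormSqChart A ψ i x := by
  unfold gradNormSqChart
  simp_rw [𝔰.spinorHermNormSq_covDeriv_eq_of_mem_overlap A hψ i j hx, ← 𝔰.covDerivBilin_apply_self A ψ i x]
  exact 𝔰.sum_bilin_frame_eq_of_mem_overlap i j hx _

/-! ### Smoothness -/

omit [g.HasLeviCivita] in
/-- The connection form along a smooth field, `y ↦ A_i(W)(y)`, is smooth at the points of the chart. [folklore] -/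
theorem contMDiffAt_form_apply (A : 𝔰.detLineBundle.Connection) {i : ι} {x : X} (hx : x ∈ 𝔰.baseSet i)
    {W : Π y : X, TangentSpace (𝓡 4) y}
    (hW : ContMDiffAt (𝓡 4) ((𝓡 4).prod 𝓘(ℝ, EuclideanSpace ℝ (Fin 4))) ∞
      (fun y : X ↦ TotalSpace.mk' (EuclideanSpace ℝ (Fin 4)) (E := (TangentSpace (𝓡 4) : X → Type _)) y (W y)) x) :
    ContMDiffAt (𝓡 4) 𝓘(ℝ, ℝ) ∞ (fun y ↦ A.form i y (W y)) x := by
  have h := smoothAt_apply_sections (α := (A.form i).toMForm) (A.smoothAt_form i x hx) (V := ![W])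
    (fun j ↦ by fin_cases j; exact hW)
  refine h.congr_of_eventuallyEq (Eventually.of_forall fun y ↦ ?_)
  simp [RealOneForm.toMForm_apply]

/-- The Levi-Civita forms along a smooth field, `y ↦ ω̃^{(i)}_{l,k}(W)(y)`, are smooth at the points of the
chart. [cite: MorganSWBook1996, §3.2] -/
theorem contMDiffAt_lcForm_apply (i : ι) {x : X} (hx : x ∈ 𝔰.baseSet i) {W : Π y : X, TangentSpace (𝓡 4) y}
    (hW : ContMDiffAt (𝓡 4) ((𝓡 4).prod 𝓘(ℝ, EuclideanSpace ℝ (Fin 4))) ∞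
      (fun y : X ↦ TotalSpace.mk' (EuclideanSpace ℝ (Fin 4)) (E := (TangentSpace (𝓡 4) : X → Type _)) y (W y)) x)
    (l k : Fin 4) :
    ContMDiffAt (𝓡 4) 𝓘(ℝ, ℝ) ∞ (fun y ↦ 𝔰.lcForm i y (W y) l k) x :=
  g.contMDiffAt_val_apply le_rfl (𝔰.contMDiffAt_leviCivita_frame_apply i k hx hW) (𝔰.contMDiffAt_frame i l hx)

/-- **The entries of the connection matrix `a_i(W) = ½ iA_i(W)·1 + dρ(ω̃(W))` along a smooth field are
smooth** at the points of the chart. [cite: MorganSWBook1996, §3.2 (3.2)] -/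
theorem contMDiffAt_connMatrix_apply_entry (A : 𝔰.detLineBundle.Connection) {i : ι} {x : X} (hx : x ∈ 𝔰.baseSet i)
    {W : Π y : X, TangentSpace (𝓡 4) y}
    (hW : ContMDiffAt (𝓡 4) ((𝓡 4).prod 𝓘(ℝ, EuclideanSpace ℝ (Fin 4))) ∞
      (fun y : X ↦ TotalSpace.mk' (EuclideanSpace ℝ (Fin 4)) (E := (TangentSpace (𝓡 4) : X → Type _)) y (W y)) x)
    (a b : Spinor) :
    ContMDiffAt (𝓡 4) 𝓘(ℝ, ℂ) ∞ (fun y ↦ 𝔰.connMatrix A i y (W y) a b) x := by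
  have hA : ContMDiffAt (𝓡 4) 𝓘(ℝ, ℂ) ∞ (fun y ↦ ((A.form i y (W y) : ℝ) : ℂ)) x :=
    (Complex.ofRealCLM.contDiff.comp_contMDiffAt (𝔰.contMDiffAt_form_apply A hx hW))
  have hΩ : ∀ l k, ContMDiffAt (𝓡 4) 𝓘(ℝ, ℂ) ∞ (fun y ↦ ((𝔰.lcForm i y (W y) l k : ℝ) : ℂ)) x := fun l k ↦
    Complex.ofRealCLM.contDiff.comp_contMDiffAt (𝔰.contMDiffAt_lcForm_apply i hx hW l k)
  have heq : (fun y ↦ 𝔰.connMatrix A i y (W y) a b) = fun y ↦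
      (2 : ℂ)⁻¹ * (I * ((A.form i y (W y) : ℝ) : ℂ)) * (1 : Matrix Spinor Spinor ℂ) a b +
        (2 : ℂ)⁻¹ * ∑ k : Fin 4, ∑ l : Fin 4,
          if k < l then ((𝔰.lcForm i y (W y) l k : ℝ) : ℂ) * (cliffordBasis k * cliffordBasis l) a b else 0 := by
    funext y
    simp only [connMatrix, spinConnectionEnd, spinRepDeriv, Matrix.add_apply, Matrix.smul_apply, smul_eq_mul,
      Matrix.sum_apply]
    congr 2
  rw [heq]
  refine (ContMDiffAt.mul_complex (ContMDiffAt.mul_complex contMDiffAt_const (ContMDiffAt.mul_complex contMDiffAt_const hA))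
    contMDiffAt_const).add (ContMDiffAt.mul_complex contMDiffAt_const ?_)
  refine ContMDiffAt.sum fun k _ ↦ ContMDiffAt.sum fun l _ ↦ ?_
  by_cases hkl : k < l
  · simp only [hkl, if_true]
    exact ContMDiffAt.mul_complex (hΩ l k) contMDiffAt_const
  · simp only [hkl, if_false]
    exact contMDiffAt_const

/-- **The components of `∇̃_{e_k} ψ_i` are smooth** at the points of the chart, for a smooth spinor field
(`∇̃_{e_k}ψ_i = dψ_i(e_k) + a_i(e_k)ψ_i`). [cite: MorganSWBook1996, §3.2 (3.2)] -/
theorem contMDiffAt_covDeriv_frame_apply (A : 𝔰.detLineBundle.Connection) {ψ : SpinorField 𝔰} (hψ : ψ.IsSmooth)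
    (i : ι) {x : X} (hx : x ∈ 𝔰.baseSet i) (k : Fin 4) (a : Spinor) :
    ContMDiffAt (𝓡 4) 𝓘(ℝ, ℂ) ∞ (fun y ↦ covDeriv A ψ i y (𝔰.frame i k y) a) x := by
  have hnhds := (𝔰.isOpen_baseSet i).mem_nhds hx
  have hs : ∀ b, ContMDiffAt (𝓡 4) 𝓘(ℝ, ℂ) ∞ (fun y ↦ ψ.toFun i y b) x := fun b ↦ (hψ i b).contMDiffAt hnhds
  have he := 𝔰.contMDiffAt_frame i k hx
  have hd : ContMDiffAt (𝓡 4) 𝓘(ℝ, ℂ) ∞ (fun y ↦ spinorDeriv (ψ.toFun i) y (𝔰.frame i k y) a) x :=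
    contMDiffAt_complexDeriv_apply (hs a) he
  have hm : ContMDiffAt (𝓡 4) 𝓘(ℝ, ℂ) ∞ (fun y ↦ (𝔰.connMatrix A i y (𝔰.frame i k y) *ᵥ ψ.toFun i y) a) x := by
    have : (fun y ↦ (𝔰.connMatrix A i y (𝔰.frame i k y) *ᵥ ψ.toFun i y) a) =
        fun y ↦ ∑ b, 𝔰.connMatrix A i y (𝔰.frame i k y) a b * ψ.toFun i y b := by
      funext y
      rfl
    rw [this]
    exact ContMDiffAt.sum fun b _ ↦ ContMDiffAt.mul_complex (𝔰.contMDiffAt_connMatrix_apply_entry A hx he a b) (hs b)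
  have heq : (fun y ↦ covDeriv A ψ i y (𝔰.frame i k y) a) =
      fun y ↦ spinorDeriv (ψ.toFun i) y (𝔰.frame i k y) a + (𝔰.connMatrix A i y (𝔰.frame i k y) *ᵥ ψ.toFun i y) a := by
    funext y
    rw [𝔰.covDeriv_eq_localCovDeriv, localCovDeriv, Pi.add_apply]
  rw [heq]
  exact hd.add hm

/-- **`|∇_Aψ|²_i` is smooth at the points of `U_i`.** [cite: MorganSWBook1996, §5.2] -/
theorem contMDiffAt_gradNormSqChart (A : 𝔰.detLineBundle.Connection) {ψ : SpinorField 𝔰} (hψ : ψ.IsSmooth)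
    (i : ι) {x : X} (hx : x ∈ 𝔰.baseSet i) :
    ContMDiffAt (𝓡 4) 𝓘(ℝ, ℝ) ∞ (fun y ↦ 𝔰.gradNormSqChart A ψ i y) x := by
  have heq : (fun y ↦ 𝔰.gradNormSqChart A ψ i y) = fun y ↦ ∑ k, ∑ a, ‖covDeriv A ψ i y (𝔰.frame i k y) a‖ ^ 2 := by
    funext y
    simp only [gradNormSqChart, spinorHermNormSq, Complex.normSq_eq_norm_sq]
  rw [heq]
  refine ContMDiffAt.sum fun k _ ↦ ContMDiffAt.sum fun a _ ↦ ?_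
  exact (contDiff_norm_sq ℝ (n := ∞)).comp_contMDiffAt (𝔰.contMDiffAt_covDeriv_frame_apply A hψ i hx k a)

/-- **`x ↦ |∇_Aψ|²(x)` (the chart read at each point) is a smooth function on `X`**: near `x` it agrees
with the smooth `|∇_Aψ|²_{i₀}` of the fixed chart at `x` (chart independence on the overlaps).
[cite: MorganSWBook1996, §5.2] -/
theorem contMDiff_gradNormSqChart_indexAt (A : 𝔰.detLineBundle.Connection) {ψ : SpinorField 𝔰} (hψ : ψ.IsSmooth) :
    ContMDiff (𝓡 4) 𝓘(ℝ, ℝ) ∞ fun x ↦ 𝔰.gradNormSqChart A ψ (𝔰.indexAt x) x := by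
  intro x
  have hi := 𝔰.mem_baseSet_indexAt x
  refine (𝔰.contMDiffAt_gradNormSqChart A hψ (𝔰.indexAt x) hi).congr_of_eventuallyEq ?_
  filter_upwards [(𝔰.isOpen_baseSet (𝔰.indexAt x)).mem_nhds hi] with y hy
  exact 𝔰.gradNormSqChart_eq_of_mem_overlap A hψ (𝔰.indexAt x) (𝔰.indexAt y) ⟨hy, 𝔰.mem_baseSet_indexAt y⟩

end SpincStructure

end Literature.Geometry.GaugeTheory

end
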